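import Mathlib
import Summits.PneNP.PneNP.Theses.OneSlice
import Summits.PneNP.PneNP.Theorems.OneSliceSliceTargetSplit
import Summits.PneNP.PneNP.Theorems.OneSliceMonotoneContinuationTowerUp
import Summits.PneNP.PneNP.Theorems.OneSliceMonotoneContinuationChainConstancy

/-!
# Route OneSlice, crux `MonotoneContinuation` (stmt-PneNP-18471), line `Sketch_ideator1_r1` (ProfileLine) — sub-goal `chain_constancy_up`

CHAIN CONSTANCY OF THE ROUNDED TRANSPORT, UPWARD (Markov on the upward tower identity; mirror image of
`chain_constancy_down`). Write `ĝ := transport j (ind f) ∈ [0,1]` for the slice-`j` transport of the indicator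
of `f` and `G(y) := [1/2 ≤ ĝ(y)]` for its rounding. For `y` of edge count `s` and `s ≤ r ≤ j ≤ C(n,2)`, the
upward neighbourhood `nbhd r y` is the family of `r`-supersets `u` of `supp y` — nonempty, of size
`C(C(n,2) - s, r - s)` (`card_nbhd_of_ge`) — and the landed tower identity `transport_tower_up` says that
`ĝ(y)` is the average of `ĝ(u)` over `u ∈ nbhd r y`. The pointwise Markov lemma `chainConstancy_markov` of the
sibling module `…ChainConstancy` then bounds the fraction of `u ∈ nbhd r y` whose rounding differs from `G(y)`
by `4·min(ĝ(y), 1 − ĝ(y))`; summing over `y ∈ slice n s` gives the registered statement.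
-/

set_option linter.dupNamespace false -- `Summit.PneNP.PneNP.…`: summit = sub-problem (D-0017)

namespace Summit.PneNP.PneNP.Theorems.MonotoneContinuation

open Literature.Computability.Complexity hiding supp mem_supp
open Finset hiding slice
open Classical
open Summit.PneNP.PneNP.Theorems.ConstantBand.Negative (Edge slice)
open Summit.PneNP.PneNP.Theorems.SliceTargetSplit (nbhd mem_nbhd transport ind card_nbhd_of_ge transport_ind_mem)

noncomputable section

variable {n : ℕ}

/-- **Chain constancy, upward** (sub-goal `chain_constancy_up` of the line `Sketch_ideator1_r1`; Markov on the
upward tower identity): for `s ≤ r ≤ j ≤ C(n,2)`, summed over the level `s`, the fraction of `r`-supersets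
`u ∈ nbhd r y` of a level-`s` point `y` whose rounded slice-`j` transport `[1/2 ≤ ĝ(u)]` differs from
`[1/2 ≤ ĝ(y)]` (`ĝ = transport j (ind f)`) is at most `4·Σ_{y ∈ slice s} min(ĝ(y), 1 − ĝ(y))`. [folklore] -/
theorem chain_constancy_up :
  ∀ (n j r s : ℕ) (f : (Edge n → Bool) → Bool), s ≤ r → r ≤ j → j ≤ n.choose 2 →
    (∑ y ∈ slice n s, (#((nbhd r y).filter fun u =>
        decide ((1 : ℝ) / 2 ≤ transport j (ind f) u) ≠ decide ((1 : ℝ) / 2 ≤ transport j (ind f) y)) : ℝ) / #(nbhd r y))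
      ≤ 4 * ∑ y ∈ slice n s, min (transport j (ind f) y) (1 - transport j (ind f) y) := by
  intro n j r s f hsr hrj hjN
  rw [mul_sum]
  refine sum_le_sum fun y hy => ?_
  have hys : edgeCount y = s := (mem_filter.1 hy).2
  have hyr : edgeCount y ≤ r := by rw [hys]; exact hsr
  have hrN : r - edgeCount y ≤ n.choose 2 - edgeCount y := Nat.sub_le_sub_right (hrj.trans hjN) _
  have hcard : 0 < #(nbhd r y) := by rw [card_nbhd_of_ge hyr]; exact Nat.choose_pos hrN
  exact chainConstancy_markov (nbhd r y) (transport j (ind f)) (transport j (ind f) y)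
    (fun u _ => (transport_ind_mem f u).1) (fun u _ => (transport_ind_mem f u).2) hcard
    (transport_ind_mem f y).1 (transport_ind_mem f y).2 (transport_tower_up n j r (ind f) y hyr hrj hjN)

end

end Summit.PneNP.PneNP.Theorems.MonotoneContinuation
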